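import Mathlib.Combinatorics.SetFamily.HarrisKleitman
import Mathlib.Tactic.Ring
import Mathlib.Tactic.Linarith
import Mathlib.Data.Finset.Max

/-!
# The excess of a down-set against an up-set of a cube: definitions, Harris–Kleitman, halves

Dossier proofs/MINE1-theoremS.md, Addendum 58 (tools T0–T2). Everything is relative to an
explicit ground set `G : Finset α` (the cube `2^G`), so that the coordinate splits at `e ∈ G` stay
inside the same framework on `G.erase e`.

* `cofG G A = {G \ a : a ∈ A}` — complements in the cube; `IsLowerIn G D` / `IsUpperIn G A` — down-
  and up-sets of the cube; `exc G D A = |D ∩ cofG G A| − |D ∩ A|` — the excess (in the lane: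
  `|R| − |Lost|`, the partnerless columns against the lost sets; exact excess is `exc = 1`);
  `crossSet D z = {v ∈ D : v ∩ z = ∅, v ∪ z ∉ D}` — the fibres over `2^{G∖z}` that `D` crosses
  (its size is `exc G D (↑z)`).
* Harris–Kleitman relative to the cube (`harris_rel`, `kleitman_rel`) and `exc_nonneg`.
* The halves at a coordinate `e ∈ G` (Mathlib's `memberSubfamily` / `nonMemberSubfamily`) are
  down- / up-sets of the cube `2^{G.erase e}`, and the complement family splits crosswise
  (`nonMember_cofG`, `member_cofG`). The strict inequality, Lemma X and the coordinate identities
  are in MSExcessIdentities.lean.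
-/

namespace PercRepro.MSTight

open Finset

variable {α : Type*} [DecidableEq α]

section Defs

/-- Complements inside the ground set `G`. -/
def cofG (G : Finset α) (A : Finset (Finset α)) : Finset (Finset α) := A.image (fun a => G \ a)

/-- An up-set of the cube `2^G`. -/
def IsUpperIn (G : Finset α) (A : Finset (Finset α)) : Prop :=
  (∀ a ∈ A, a ⊆ G) ∧ ∀ a ∈ A, ∀ t, a ⊆ t → t ⊆ G → t ∈ A

/-- A down-set of the cube `2^G`. -/
def IsLowerIn (G : Finset α) (D : Finset (Finset α)) : Prop :=
  (∀ v ∈ D, v ⊆ G) ∧ IsLowerSet (D : Set (Finset α))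

/-- The excess `|D ∩ Ā| − |D ∩ A|` of `D` against `A` in the cube `2^G`. -/
def exc (G : Finset α) (D A : Finset (Finset α)) : ℤ := ((D ∩ cofG G A).card : ℤ) - (D ∩ A).card

/-- The fibres over `2^{G ∖ z}` crossed by `D`: `v ∈ D` with `v ∩ z = ∅` and `v ∪ z ∉ D`. -/
def crossSet (D : Finset (Finset α)) (z : Finset α) : Finset (Finset α) :=
  D.filter fun v => Disjoint v z ∧ v ∪ z ∉ D

/-- `z` is a minimal member of `A`. -/
def IsMinIn (A : Finset (Finset α)) (z : Finset α) : Prop := z ∈ A ∧ ∀ y ∈ A, y ⊆ z → y = z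

variable {G : Finset α} {A D : Finset (Finset α)} {s z : Finset α}

/-- Membership in `crossSet`. -/
theorem mem_crossSet : s ∈ crossSet D z ↔ s ∈ D ∧ Disjoint s z ∧ s ∪ z ∉ D := by
  simp [crossSet]

/-- Membership in `cofG` (existential form). -/
theorem mem_cofG : s ∈ cofG G A ↔ ∃ a ∈ A, G \ a = s := by
  simp [cofG]

/-- Membership in `cofG` for a subset of the ground set: `s ∈ cofG G A ↔ G ∖ s ∈ A`. -/
theorem mem_cofG_iff (hA : ∀ a ∈ A, a ⊆ G) (hs : s ⊆ G) : s ∈ cofG G A ↔ G \ s ∈ A := by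
  rw [mem_cofG]
  constructor
  · rintro ⟨a, ha, rfl⟩
    rwa [Finset.sdiff_sdiff_eq_self (hA a ha)]
  · intro h
    exact ⟨G \ s, h, Finset.sdiff_sdiff_eq_self hs⟩

/-- Members of `cofG G A` are subsets of `G`. -/
theorem subset_of_mem_cofG (h : s ∈ cofG G A) : s ⊆ G := by
  obtain ⟨a, -, rfl⟩ := mem_cofG.1 h
  exact sdiff_subset

/-- Complementation is injective on subsets of `G`: `|cofG G A| = |A|`. -/
theorem card_cofG (hA : ∀ a ∈ A, a ⊆ G) : (cofG G A).card = A.card := by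
  unfold cofG
  apply card_image_of_injOn
  intro a ha b hb hab
  have ha' := hA a ha
  have hb' := hA b hb
  simp only at hab
  rw [← Finset.sdiff_sdiff_eq_self ha', hab, Finset.sdiff_sdiff_eq_self hb']

/-- Complementation is an involution on families of subsets of `G`. -/
theorem cofG_cofG (hA : ∀ a ∈ A, a ⊆ G) : cofG G (cofG G A) = A := by
  ext s
  constructor
  · intro h
    obtain ⟨b, hb, rfl⟩ := mem_cofG.1 h
    obtain ⟨a, ha, rfl⟩ := mem_cofG.1 hb
    rwa [Finset.sdiff_sdiff_eq_self (hA a ha)]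
  · intro h
    exact mem_cofG.2 ⟨G \ s, mem_cofG.2 ⟨s, h, rfl⟩, Finset.sdiff_sdiff_eq_self (hA s h)⟩

/-- `cofG` is monotone. -/
theorem cofG_subset_cofG (h : A ⊆ D) : cofG G A ⊆ cofG G D := by
  intro s hs
  obtain ⟨a, ha, rfl⟩ := mem_cofG.1 hs
  exact mem_cofG.2 ⟨a, h ha, rfl⟩

/-- `cofG` of a set difference of families is the set difference of the `cofG`s. -/
theorem cofG_sdiff (hD : ∀ a ∈ D, a ⊆ G) (h : A ⊆ D) :
    cofG G (D \ A) = cofG G D \ cofG G A := by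
  ext s
  by_cases hs : s ⊆ G
  · have hDA : ∀ a ∈ D \ A, a ⊆ G := fun a ha => hD a (mem_sdiff.1 ha).1
    rw [mem_cofG_iff hDA hs, mem_sdiff, mem_sdiff, mem_cofG_iff hD hs,
      mem_cofG_iff (fun a ha => hD a (h ha)) hs]
  · constructor
    · intro h'; exact absurd (subset_of_mem_cofG h') hs
    · intro h'; exact absurd (subset_of_mem_cofG (mem_sdiff.1 h').1) hs

/-- The complement family of an up-set of the cube is a down-set of the cube. -/
theorem isLowerIn_cofG (hA : IsUpperIn G A) : IsLowerIn G (cofG G A) := by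
  refine ⟨fun s hs => subset_of_mem_cofG hs, ?_⟩
  intro s t hts hs
  simp only [mem_coe] at hs ⊢
  have hsG := subset_of_mem_cofG hs
  rw [mem_cofG_iff hA.1 hsG] at hs
  rw [mem_cofG_iff hA.1 (hts.trans hsG)]
  exact hA.2 _ hs _ (sdiff_subset_sdiff (subset_refl _) hts) sdiff_subset

/-- The complement family of a down-set of the cube is an up-set of the cube. -/
theorem isUpperIn_cofG (hD : IsLowerIn G D) : IsUpperIn G (cofG G D) := by
  refine ⟨fun s hs => subset_of_mem_cofG hs, ?_⟩
  intro s hs t hst htG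
  have hsG := subset_of_mem_cofG hs
  rw [mem_cofG_iff hD.1 hsG] at hs
  rw [mem_cofG_iff hD.1 htG]
  exact hD.2 (sdiff_subset_sdiff (subset_refl _) hst) hs

end Defs

section HarrisKleitman

variable {G : Finset α} {A D E : Finset (Finset α)}

/-- Harris–Kleitman for two down-sets of the cube `2^G`. -/
theorem harris_rel (hD : IsLowerIn G D) (hE : IsLowerIn G E) :
    D.card * E.card ≤ 2 ^ G.card * (D ∩ E).card :=
  hD.2.le_card_inter_finset' hE.2 hD.1 hE.1

/-- The complement of an up-set inside the powerset is a down-set of the cube. -/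
theorem isLowerIn_powerset_sdiff (hA : IsUpperIn G A) : IsLowerIn G (G.powerset \ A) := by
  refine ⟨fun v hv => mem_powerset.1 (mem_sdiff.1 hv).1, ?_⟩
  intro s t hts hs
  simp only [mem_coe, mem_sdiff, mem_powerset] at hs ⊢
  refine ⟨hts.trans hs.1, fun ht => hs.2 (hA.2 t ht s hts hs.1)⟩

/-- Harris–Kleitman for a down-set and an up-set of the cube `2^G` (anticorrelation). -/
theorem kleitman_rel (hD : IsLowerIn G D) (hA : IsUpperIn G A) :
    2 ^ G.card * (D ∩ A).card ≤ D.card * A.card := by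
  set L := G.powerset \ A with hL
  have hLlow := isLowerIn_powerset_sdiff hA
  have h1 := harris_rel hD hLlow
  have hAL : A.card + L.card = 2 ^ G.card := by
    have hsub : A ⊆ G.powerset := fun a ha => mem_powerset.2 (hA.1 a ha)
    rw [hL, card_sdiff_of_subset hsub, card_powerset]
    have := card_le_card hsub
    rw [card_powerset] at this
    omega
  have hDA : (D ∩ A).card + (D ∩ L).card = D.card := by
    have hdisj : Disjoint (D ∩ A) (D ∩ L) := by
      rw [disjoint_iff_ne]
      intro a ha b hb hab
      subst hab
      exact (mem_sdiff.1 (mem_inter.1 hb).2).2 (mem_inter.1 ha).2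
    rw [← card_union_of_disjoint hdisj]
    congr 1
    ext v
    simp only [mem_union, mem_inter, hL, mem_sdiff, mem_powerset]
    constructor
    · rintro (⟨h, -⟩ | ⟨h, -⟩) <;> exact h
    · intro hv
      by_cases hvA : v ∈ A
      · exact Or.inl ⟨hv, hvA⟩
      · exact Or.inr ⟨hv, hD.1 v hv, hvA⟩
  nlinarith [h1, hAL, hDA]

/-- The excess is nonnegative. -/
theorem exc_nonneg (hD : IsLowerIn G D) (hA : IsUpperIn G A) : 0 ≤ exc G D A := by
  unfold exc
  have h1 := kleitman_rel hD hA
  have h2 := harris_rel hD (isLowerIn_cofG hA)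
  rw [card_cofG hA.1] at h2
  have h3 : 2 ^ G.card * (D ∩ A).card ≤ 2 ^ G.card * (D ∩ cofG G A).card := h1.trans h2
  have h4 := Nat.le_of_mul_le_mul_left h3 (by positivity)
  omega

end HarrisKleitman

section Halves

variable {G : Finset α} {A D : Finset (Finset α)} {e : α} {s z : Finset α}

/-- The `e`-free subfamily of a down-set of `2^G` is a down-set of `2^{G.erase e}`. -/
theorem isLowerIn_nonMember (hD : IsLowerIn G D) : IsLowerIn (G.erase e) (D.nonMemberSubfamily e) := by
  refine ⟨?_, hD.2.nonMemberSubfamily⟩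
  intro v hv
  obtain ⟨hv, hev⟩ := mem_nonMemberSubfamily.1 hv
  intro x hx
  exact mem_erase.2 ⟨fun h => hev (h ▸ hx), hD.1 v hv hx⟩

/-- The `e`-subfamily of a down-set of `2^G` is a down-set of `2^{G.erase e}`. -/
theorem isLowerIn_member (hD : IsLowerIn G D) : IsLowerIn (G.erase e) (D.memberSubfamily e) := by
  refine ⟨?_, hD.2.memberSubfamily⟩
  intro v hv
  obtain ⟨hv, hev⟩ := mem_memberSubfamily.1 hv
  intro x hx
  exact mem_erase.2 ⟨fun h => hev (h ▸ hx), hD.1 _ hv (mem_insert_of_mem hx)⟩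

/-- The `e`-free subfamily of an up-set of `2^G` is an up-set of `2^{G.erase e}`. -/
theorem isUpperIn_nonMember (hA : IsUpperIn G A) : IsUpperIn (G.erase e) (A.nonMemberSubfamily e) := by
  refine ⟨?_, ?_⟩
  · intro v hv
    obtain ⟨hv, hev⟩ := mem_nonMemberSubfamily.1 hv
    intro x hx
    exact mem_erase.2 ⟨fun h => hev (h ▸ hx), hA.1 v hv hx⟩
  · intro a ha t hat htG
    obtain ⟨ha, hea⟩ := mem_nonMemberSubfamily.1 ha
    refine mem_nonMemberSubfamily.2 ⟨hA.2 a ha t hat (htG.trans (erase_subset _ _)), ?_⟩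
    intro het
    exact (mem_erase.1 (htG het)).1 rfl

/-- For `e ∈ G`, the `e`-subfamily of an up-set of `2^G` is an up-set of `2^{G.erase e}`. -/
theorem isUpperIn_member (he : e ∈ G) (hA : IsUpperIn G A) :
    IsUpperIn (G.erase e) (A.memberSubfamily e) := by
  refine ⟨?_, ?_⟩
  · intro v hv
    obtain ⟨hv, hev⟩ := mem_memberSubfamily.1 hv
    intro x hx
    exact mem_erase.2 ⟨fun h => hev (h ▸ hx), hA.1 _ hv (mem_insert_of_mem hx)⟩
  · intro a ha t hat htG
    obtain ⟨ha, hea⟩ := mem_memberSubfamily.1 ha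
    have het : e ∉ t := fun het => (mem_erase.1 (htG het)).1 rfl
    refine mem_memberSubfamily.2 ⟨?_, het⟩
    refine hA.2 _ ha _ (insert_subset_insert _ hat) ?_
    exact insert_subset he (htG.trans (erase_subset _ _))

/-- For a down-set, the `e`-subfamily sits inside the `e`-free subfamily. -/
theorem member_subset_nonMember_of_lower (hD : IsLowerIn G D) :
    D.memberSubfamily e ⊆ D.nonMemberSubfamily e :=
  hD.2.memberSubfamily_subset_nonMemberSubfamily

/-- For an up-set of the cube and `e ∈ G`, the `e`-free subfamily sits inside the `e`-subfamily. -/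
theorem nonMember_subset_member_of_upper (he : e ∈ G) (hA : IsUpperIn G A) :
    A.nonMemberSubfamily e ⊆ A.memberSubfamily e := by
  intro s hs
  obtain ⟨hs, hes⟩ := mem_nonMemberSubfamily.1 hs
  exact mem_memberSubfamily.2 ⟨hA.2 s hs _ (subset_insert e s) (insert_subset he (hA.1 s hs)), hes⟩

/-- `2 ^ |G| = 2 · 2 ^ |G.erase e|` for `e ∈ G`. -/
theorem two_pow_card_erase (he : e ∈ G) : 2 ^ G.card = 2 * 2 ^ (G.erase e).card := by
  rw [← card_erase_add_one he, pow_succ, mul_comm]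

/-- Cardinality of an intersection, split at `e`. -/
theorem card_inter_split (e : α) (X Y : Finset (Finset α)) :
    (X ∩ Y).card = (X.memberSubfamily e ∩ Y.memberSubfamily e).card +
      (X.nonMemberSubfamily e ∩ Y.nonMemberSubfamily e).card := by
  rw [← memberSubfamily_inter, ← nonMemberSubfamily_inter,
    card_memberSubfamily_add_card_nonMemberSubfamily]

/-- The `e`-free part of the complement family is the complement family of the `e`-subfamily. -/
theorem nonMember_cofG (he : e ∈ G) :
    (cofG G A).nonMemberSubfamily e = cofG (G.erase e) (A.memberSubfamily e) := by
  ext s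
  rw [mem_nonMemberSubfamily, mem_cofG, mem_cofG]
  constructor
  · rintro ⟨⟨a, ha, rfl⟩, hes⟩
    have hea : e ∈ a := by
      by_contra h
      exact hes (mem_sdiff.2 ⟨he, h⟩)
    refine ⟨a.erase e, mem_memberSubfamily.2 ⟨by rwa [insert_erase hea], notMem_erase e a⟩, ?_⟩
    ext x
    simp only [mem_sdiff, mem_erase]
    constructor
    · rintro ⟨⟨hxe, hxG⟩, hxa⟩
      exact ⟨hxG, fun h => hxa ⟨hxe, h⟩⟩
    · rintro ⟨hxG, hxa⟩
      refine ⟨⟨fun h => hxa (h ▸ hea), hxG⟩, fun h => hxa h.2⟩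
  · rintro ⟨t, ht, rfl⟩
    obtain ⟨ht, het⟩ := mem_memberSubfamily.1 ht
    refine ⟨⟨insert e t, ht, ?_⟩, ?_⟩
    · ext x
      simp only [mem_sdiff, mem_erase, mem_insert]
      tauto
    · simp

/-- The `e`-part of the complement family is the complement family of the `e`-free subfamily. -/
theorem member_cofG (he : e ∈ G) :
    (cofG G A).memberSubfamily e = cofG (G.erase e) (A.nonMemberSubfamily e) := by
  ext s
  rw [mem_memberSubfamily, mem_cofG, mem_cofG]
  constructor
  · rintro ⟨⟨a, ha, hae⟩, hes⟩
    have hea : e ∉ a := by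
      intro h
      have : e ∈ G \ a := by rw [hae]; exact mem_insert_self e s
      exact (mem_sdiff.1 this).2 h
    refine ⟨a, mem_nonMemberSubfamily.2 ⟨ha, hea⟩, ?_⟩
    ext x
    simp only [mem_sdiff, mem_erase]
    constructor
    · rintro ⟨⟨hxe, hxG⟩, hxa⟩
      have : x ∈ insert e s := by rw [← hae]; exact mem_sdiff.2 ⟨hxG, hxa⟩
      rcases mem_insert.1 this with rfl | h
      · exact absurd rfl hxe
      · exact h
    · intro hxs
      have : x ∈ G \ a := by rw [hae]; exact mem_insert_of_mem hxs
      exact ⟨⟨fun h => hes (h ▸ hxs), (mem_sdiff.1 this).1⟩, (mem_sdiff.1 this).2⟩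
  · rintro ⟨t, ht, rfl⟩
    obtain ⟨ht, het⟩ := mem_nonMemberSubfamily.1 ht
    refine ⟨⟨t, ht, ?_⟩, ?_⟩
    · ext x
      simp only [mem_sdiff, mem_erase, mem_insert]
      constructor
      · rintro ⟨hxG, hxt⟩
        by_cases hxe : x = e
        · exact Or.inl hxe
        · exact Or.inr ⟨⟨hxe, hxG⟩, hxt⟩
      · rintro (rfl | ⟨⟨-, hxG⟩, hxt⟩)
        · exact ⟨he, het⟩
        · exact ⟨hxG, hxt⟩
    · simp

end Halves

end PercRepro.MSTight
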